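import Summits.Ventures.CertifiedManyBodySolver.Certificates.HubbardSquare_n7o8_stiffness_chordOneStation_c1l_boxes_A
import Summits.Ventures.CertifiedManyBodySolver.Observables.StiffnessApexTransportFermiSeaBoxes
import HarnessLib
import HarnessLib.Audit

/-!
# Ventures/CertifiedManyBodySolver — Certificates/HubbardSquare_n7o8_stiffness_chordOneStation_twins9o8_c1l_boxes_A.lean

HONEST FRAMING: the ELECTRON-DOPED `n = 9/8` particle–hole TWINS (`4 ∣ L`, `(t′, 7/8) ↦ (−t′, 9/8)`; `box_twin_nine_div_eight`,
`ObsStiffnessSeqCeilingAt.twin_nine_div_eight`) of the (N20) «⅞ COLUMN d LOW-U UNDER THE (¾∣1) CHORD WITH THE LUC ∕ SECANT n = 1 MEMBER» words of `Certificates/HubbardSquare_n7o8_stiffness_chordOneStation_c1l_boxes_A.lean` (hubbard-fast-reuse-2 g19;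
1 twins in this file; same constants, mirrored hopping intervals). Dictionary class: one-sided stiffness CEILINGS, transport-only, conditional on EXACTLY the premises of their
7/8 originals (registry row #568 BY NAME; the ¾ `t′ ≥ 0` face `hW3p` BY VALUE — R12.46, DISCHARGED BY NAME on #658; the n = 1 member BY NAME — #21/#396/#410/#497/#487 via the (N19)
secant readers; the kernel Fermi-sea member is a Literature THEOREM — no hypothesis).
«other observable», Δε = 0; not registry rows; not a superconductivity or `T_c` verdict; NO summit statement is proved by this seat. Zero compute, no definition, no new claim
node, no `sorry`. Cell `pub/hubbard-fast` (D-0154 (1)(A)), seat `hubbard-fast-reuse-2` g19 (object (N20)).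
References: E. H. Lieb, F. Y. Wu, Physica A 321 (2003) 1, §1 eq. (3) [LiebWuPhysicaA2003]; D. J. Scalapino, S. R. White, S.-C. Zhang, PRB 47 (1993) 7995, §II [ScalapinoWhiteZhang1993].
-/

noncomputable section

namespace Summit.Ventures.CertifiedManyBodySolver.Certificates

open Literature.MathematicalPhysics.QuantumLattice
open Literature.MathematicalPhysics.QuantumLattice.ThermodynamicLimit
open Summit.Ventures.CertifiedManyBodySolver.Observables

/-- 9/8 twin of `n7o8_oblqCOc1lMixBox_U25o4_13o2_tp1o40_1o20_stiffnessWord_of`: the mirrored box `[25/4, 13/2] × [-1/20, -1/40]` at `n = 9/8` (`4 ∣ L`), `ρ_s ≤ 0.4032628`. [cite: LiebWuPhysicaA2003, §1 eq. (3)] -/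
theorem n9o8_oblqCOc1lMixBox_U25o4_13o2_tp1o40_1o20_twin_of (h568 : cert_r568_bs_GU2n7o8tp0_w3_b4_R2_ob5p2_kry1_kry2c3rel_eom8_hanK7B4D4_menulite_core_U2_focert_it3150) (hW3p : ∀ U s : ℝ, 0 ≤ U → 0 ≤ s → energyDensityTT' 1 s U (3 / 4) ≤ (((-2467887174335/2199023255552 : ℚ)) : ℝ) + (((252892912483/8796093022208 : ℚ)) : ℝ) * U + (((-2685394635437/8796093022208 : ℚ)) : ℝ) * s) (h497 : cert_r497_hubSQ_hanK7R6_U4_r5_e4_so4blk) (h21 : cert_r21_luc_tl_upper_n1_U6) :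
    ∀ U ∈ Set.Icc (25/4 : ℝ) (13/2), ∀ t ∈ Set.Icc (-1/20 : ℝ) (-1/40),
      ObsStiffnessSeqCeilingOnMultiples 4 t U (9 / 8) (1008157/2500000) :=
  fun U hU t ht => box_twin_nine_div_eight (n7o8_oblqCOc1lMixBox_U25o4_13o2_tp1o40_1o20_stiffnessWord_of h568 hW3p h497 h21) U hU t ⟨by norm_num; linarith [ht.1], by norm_num; linarith [ht.2]⟩

end Summit.Ventures.CertifiedManyBodySolver.Certificates

end
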